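import Mathlib
import Summits.ValiantsHypothesis.ValiantsHypothesis.Theses.ProjectionRigidity
import Literature.Computability.AlgebraicComplexity.GrenetProjection

/-!
# Crux `ProjectionRigidity.ProjOptimalUnique` (stmt-ValiantsHypothesis-16001), line `registered` (birth) —
registered stub `stub_pivotThree`: THE PIVOT LEMMA for `7 × 7` representations of `per_3`

**Claim settled** (stub PV@3 of the lead's skeleton, TRUE).  Let `A` be ANY `7 × 7` matrix of affine linear
forms over `ℂ` with `det A = per_3` and let `w` be an index whose diagonal entry `A_{ww}` is a NONZERO
CONSTANT.  Then row `w` contains a non-constant entry off the diagonal, and so does column `w`.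
For an acyclic-form (branching-program) projection the diagonal entries `N_{ii}`, `i > 0`, are the constant
loops, so the lemma says: every internal vertex carries a VARIABLE in-arc and a VARIABLE out-arc — the
filter that, together with the two-line lemma, drives the lead's exhaustive classification of acyclic
`7 × 7` projections of `per_3` (EVIDENCE-n3.md §1 (S5c), §2).

Proof.  If row `w` were constant off the diagonal, the Schur complement of the pivot `A_{ww} = c`
(`Matrix.det_fromBlocks₂₂` after reindexing `Fin 7 ≃ Fin 6 ⊕ Unit` with `w ↦ inr ()`) is a `6 × 6`
matrix `S = A₁₁ − A₁₂ c⁻¹ A₂₁` whose entries are affine (column `w` is affine, row `w` constant), with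
`c · det S = per_3`; rescaling one row gives an affine determinantal representation of `per_3` of size `6`,
contradicting `dc(per_3) ≥ 7` (Alper–Bogart–Velasco; tree `seven_le_determinantalComplexity_perPoly_three`,
`GrenetProjection.lean`).  The column case is the row case for `Aᵀ`.  Unconditional.

References: [AlperBogartVelasco2017] Cor. 1.4; [MignonRessayre2004] §1 (`dc`); [HuttenhainIkenmeyer2016] §2
(digraph/branching-program reading of a matrix).
-/

-- layout Summits/ValiantsHypothesis/ValiantsHypothesis forces the duplicated namespace component
set_option linter.dupNamespace false

noncomputable section

namespace Summit.ValiantsHypothesis.ValiantsHypothesis.Theorems.ProjectionRigidityProjOptimalUnique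

open MvPolynomial Matrix Module
open Literature.Computability.AlgebraicComplexity

namespace StubPivotThree

/-- **Row case of the pivot lemma.**  A `7 × 7` affine representation `A` of `per_3` over `ℂ` cannot have
an index `w` with `A_{ww} = c ≠ 0` constant and all other entries of ROW `w` constant: the Schur
complement of that pivot would be a `6 × 6` affine representation of `per_3`. [cite: AlperBogartVelasco2017, Cor. 1.4] -/
theorem false_of_constant_row (A : Matrix (Fin 7) (Fin 7) (MvPolynomial (Fin 3 × Fin 3) ℂ))
    (hdeg : ∀ i j, (A i j).totalDegree ≤ 1) (hdet : A.det = perPoly (Fin 3) ℂ)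
    (w : Fin 7) (c : ℂ) (hc : c ≠ 0) (hww : A w w = C c)
    (hrow : ∀ j, j ≠ w → ∃ d : ℂ, A w j = C d) : False := by
  classical
  -- reindex so that `w` is the last (unit) block
  let e : Fin 7 ≃ Fin 6 ⊕ Unit :=
    (finSuccEquiv' w).trans (Equiv.optionEquivSumPUnit (Fin 6))
  have hew : e w = Sum.inr () := by
    simp [e, finSuccEquiv'_at]
  have hesymm : e.symm (Sum.inr ()) = w := by
    rw [← hew, Equiv.symm_apply_apply]
  have heinl : ∀ i : Fin 6, e.symm (Sum.inl i) ≠ w := by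
    intro i h
    have := congr_arg e h
    rw [Equiv.apply_symm_apply, hew] at this
    cases this
  let M : Matrix (Fin 6 ⊕ Unit) (Fin 6 ⊕ Unit) (MvPolynomial (Fin 3 × Fin 3) ℂ) :=
    Matrix.reindex e e A
  have hM : ∀ p q, M p q = A (e.symm p) (e.symm q) := fun _ _ => rfl
  have hdetM : M.det = perPoly (Fin 3) ℂ := by
    rw [Matrix.det_reindex_self, hdet]
  -- the pivot block and its inverse
  have hDval : M.toBlocks₂₂ = fun _ _ => C c := by
    funext a b
    rw [Matrix.toBlocks₂₂, Matrix.of_apply, hM]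
    cases a; cases b
    rw [hesymm, hww]
  let Dinv : Matrix Unit Unit (MvPolynomial (Fin 3 × Fin 3) ℂ) := fun _ _ => C c⁻¹
  have hmul1 : M.toBlocks₂₂ * Dinv = 1 := by
    ext a b
    cases a; cases b
    rw [Matrix.mul_apply, Fintype.sum_unique, hDval, Matrix.one_apply_eq, ← map_mul,
      mul_inv_cancel₀ hc, map_one]
  have hmul2 : Dinv * M.toBlocks₂₂ = 1 := by
    ext a b
    cases a; cases b
    rw [Matrix.mul_apply, Fintype.sum_unique, hDval, Matrix.one_apply_eq, ← map_mul,
      inv_mul_cancel₀ hc, map_one]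
  letI : Invertible M.toBlocks₂₂ := ⟨Dinv, hmul2, hmul1⟩
  have hinvD : ⅟(M.toBlocks₂₂) = Dinv := rfl
  -- Schur complement
  set S : Matrix (Fin 6) (Fin 6) (MvPolynomial (Fin 3 × Fin 3) ℂ) :=
    M.toBlocks₁₁ - M.toBlocks₁₂ * ⅟(M.toBlocks₂₂) * M.toBlocks₂₁ with hS
  have hdetS : M.det = (M.toBlocks₂₂).det * S.det := by
    have h := Matrix.det_fromBlocks₂₂ M.toBlocks₁₁ M.toBlocks₁₂ M.toBlocks₂₁ M.toBlocks₂₂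
    rw [Matrix.fromBlocks_toBlocks] at h
    rw [h]
  have hdetD : (M.toBlocks₂₂).det = C c := by
    rw [Matrix.det_unique, hDval]
  -- entries of `S` are affine: row `w` of `A` is constant, column `w` affine
  obtain ⟨d, hd⟩ : ∃ d : Fin 6 → ℂ, ∀ j, A w (e.symm (Sum.inl j)) = C (d j) := by
    have := fun j => hrow (e.symm (Sum.inl j)) (heinl j)
    choose d hd using this
    exact ⟨d, hd⟩
  have hSaff : ∀ i j, (S i j).totalDegree ≤ 1 := by
    intro i j
    rw [hS, Matrix.sub_apply]
    refine (totalDegree_sub _ _).trans (max_le ?_ ?_)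
    · rw [Matrix.toBlocks₁₁, Matrix.of_apply, hM]
      exact hdeg _ _
    · rw [Matrix.mul_apply, Fintype.sum_unique, Matrix.mul_apply, Fintype.sum_unique, hinvD,
        Matrix.toBlocks₁₂, Matrix.of_apply, Matrix.toBlocks₂₁, Matrix.of_apply, hM, hM, hesymm, hd j]
      refine (totalDegree_mul _ _).trans ?_
      rw [totalDegree_C, add_zero]
      refine (totalDegree_mul _ _).trans ?_
      change (A (e.symm (Sum.inl i)) w).totalDegree + (C c⁻¹ : MvPolynomial _ ℂ).totalDegree ≤ 1
      rw [totalDegree_C, add_zero]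
      exact hdeg _ _
  -- rescale row `0` of `S` by `c` to get an affine representation of `per_3` of size `6`
  have hper : (C c : MvPolynomial (Fin 3 × Fin 3) ℂ) * S.det = perPoly (Fin 3) ℂ := by
    rw [← hdetD, ← hdetS, hdetM]
  let S' : Matrix (Fin 6) (Fin 6) (MvPolynomial (Fin 3 × Fin 3) ℂ) :=
    S.updateRow 0 ((C c : MvPolynomial (Fin 3 × Fin 3) ℂ) • S 0)
  have hdetS' : S'.det = perPoly (Fin 3) ℂ := by
    change (S.updateRow 0 ((C c : MvPolynomial (Fin 3 × Fin 3) ℂ) • S 0)).det = _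
    rw [Matrix.det_updateRow_smul, Matrix.updateRow_eq_self, hper]
  have hS'aff : ∀ i j, (S' i j).totalDegree ≤ 1 := by
    intro i j
    change (S.updateRow 0 ((C c : MvPolynomial (Fin 3 × Fin 3) ℂ) • S 0) i j).totalDegree ≤ 1
    by_cases hi : i = 0
    · rw [hi, Matrix.updateRow_self, Pi.smul_apply, smul_eq_mul]
      refine (totalDegree_mul _ _).trans ?_
      rw [totalDegree_C, zero_add]
      exact hSaff _ _
    · rw [Matrix.updateRow_ne hi]
      exact hSaff _ _
  have h6 : determinantalComplexity (perPoly (Fin 3) ℂ) ≤ 6 :=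
    determinantalComplexity_le_of_hasDetRepr ⟨S', hS'aff, hdetS'⟩
  have h7 := seven_le_determinantalComplexity_perPoly_three
  omega

end StubPivotThree

/-- **PIVOT LEMMA for `7 × 7` representations of `per_3`** (registered stub `stub_pivotThree`, crux
stmt-ValiantsHypothesis-16001, line `registered`).  If `A` is a `7 × 7` matrix of affine linear forms over
`ℂ` with `det A = per_3` and `A_{ww} = c` is a nonzero constant, then some off-diagonal entry of ROW `w`
and some off-diagonal entry of COLUMN `w` are non-constant.  (For an acyclic-form projection: every internal
vertex has a variable in-arc and a variable out-arc.)  Row case: `StubPivotThree.false_of_constant_row`;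
column case: the same for `Aᵀ`. -/
theorem stub_pivotThree :
    ∀ A : Matrix (Fin 7) (Fin 7) (MvPolynomial (Fin 3 × Fin 3) ℂ),
      (∀ i j, (A i j).totalDegree ≤ 1) →
      A.det = Literature.Computability.AlgebraicComplexity.perPoly (Fin 3) ℂ →
      ∀ (w : Fin 7) (c : ℂ), c ≠ 0 → A w w = MvPolynomial.C c →
        (∃ j, j ≠ w ∧ ∀ d : ℂ, A w j ≠ MvPolynomial.C d) ∧
        (∃ i, i ≠ w ∧ ∀ d : ℂ, A i w ≠ MvPolynomial.C d) := by
  intro A hdeg hdet w c hc hww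
  constructor
  · by_contra H
    push Not at H
    exact StubPivotThree.false_of_constant_row A hdeg hdet w c hc hww
      fun j hj => by
        obtain ⟨d, hd⟩ := H j hj
        exact ⟨d, hd⟩
  · by_contra H
    push Not at H
    refine StubPivotThree.false_of_constant_row Aᵀ (fun i j => hdeg j i) ?_ w c hc ?_ ?_
    · rw [Matrix.det_transpose, hdet]
    · rw [Matrix.transpose_apply, hww]
    · intro j hj
      obtain ⟨d, hd⟩ := H j hj
      exact ⟨d, by rw [Matrix.transpose_apply, hd]⟩

end Summit.ValiantsHypothesis.ValiantsHypothesis.Theorems.ProjectionRigidityProjOptimalUnique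

end
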